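import Summits.QuantumFields.BalabanUV.Beta.GAN24.CombT2ShapeEvenEnd
import Summits.QuantumFields.BalabanUV.Beta.GAN24.CombLegSourceRuledClass

/-!
# `BalabanUV.Beta.GAN24.CombT2ShapeEvenEndRows` — binder row G-an2-4 ∕ (CONV-C), TRANSFER-III (the (α-0) chain at row D1's literal of record (III′)), link L8b′ ∕ L8c:
# **THE «T2Shape^ε» END FOR THE COMB-CHART `T₂` TOWER WITH THE RELATIVE SOURCE's TWO ROWS DISCHARGED INTO THE CELL CURRENCY — `hb ∕ hZ` of the OWNER gan24-p1 g46's T4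
# `CombT2ShapeEvenEnd.locStencil₂_halfMember_comb_three_of_relSource_rows` ⟸ the source row `Hb` (W4's spelling), the cell row `hcell` (leaf-03 g79's (C-6)
# `CombHalfMemberCellOfDivergences.comb_cell_rows_of_divergence_rows`' conclusion at `Z l := y′_l`) and the charge row `hC` (T4's `hZ`.2; MY g80 (vii)
# `CombRelSourceHalfCharge.zsym_relSource_comb_half` gives it from row (C) at the comb data); the covariance half of `hZ` DISCHARGED by leaf-03 g81 W2's
# `halfSource_comb_translate ∕ halfMember_comb_translate` ⨾ leaf-18's `lin4_translate` at W1's `shiftK_unitK_GcombSh` ∕ `shiftK_unitKInvStep` ⨾ `add ∕ sub_translate_pi`** — the (III′)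
# twin of the OWNER gan24-p1 g33's (E) `T2ShapeEvenEndRows.locStencil₂_halfMember_three_of_rows` (there the source rows came from p2's F4 via (hS, hSall); here `Hb` is displayed —
# road-P2's (III′) source-row socket), typed as a COURTESY twin by the crew's kept leaf prover (G-an2-4 CRUX TEAM (2), leaf prover `b2b-balaban-gan24-formalise-leaf-01`, gen 82;
# credit: the OWNER's (E) text token for token; the OWNER at first refusal on the bytes (journal W-2 ∕ INTENT-5); no existing file touched)

NOT IN PRINT; OUR BOOKKEEPING ([folklore] composition BY NAME; 0 `def`, 0 cited facts, 0 `def … : Prop`, 0 sorry).  HONEST FRAMING (cell contract, verbatim): «discharging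
`BetaPertH` makes Bałaban's UV stability UNCONDITIONAL — a real constructive-QFT result; it is NOT the continuum limit and NOT the Clay problem.»  HONEST DEPENDENCY (verbatim):
«continuum YM on T⁴ ⇐ BetaPertH ∧ nine spine estimates (0/9 proved); BetaPertH ⇐ (D1) ∧ (D4) ∧ CAP+tail; G-an2-4 gates asym, D1 and NE2/3/4.»

WHAT (`d = 3`, `2 ≤ Lc`, `|cE₂| ≤ Lc^8`, `|ε| ≤ 1`, any `tabs : SymTables 3 Lc` with off-diagonal border `tabs.vh₂S` (`hBff hBmm`) localised at `(CB, δB)`, any `cE cVH cΛ cB Tc`;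
`T̃′♮_n`, `y′_n := ½ • (T̃′♮_n + ε • P T̃′♮_n)`, `G′♮_n := unitK_n (GcombSh Lc n)`, `K♮_n := unitK_n (KInvStep Lc n)`, the dressed comb-chart source `b̃′♮_l`, the cell
`cell′^ε_l := 𝒜^{G′}_l y′_l − 𝒜^{K}_l y′_l` (`𝒜 = lin4 (cE₂·Lc^{2(3+1)})`), the relative source `b′^{rel,ε}_l := ½ • (b̃′♮_l + ε • P b̃′♮_l) + cell′^ε_l`):
**`locStencil₂_halfMember_comb_three_of_rows`** — `∃ C₂ δ₂ > 0, ∀ n, LocStencil₂ (y′_n) C₂ δ₂` («T2Shape^ε» at (III′), T4's conclusion VERBATIM) from the DISPLAYED rows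
`Hb : ∀ l, LocStencil₂ (b̃′♮_l) Cb δb`, `hcell : ∀ l, LocStencil₂ (cell′^ε_l) Ccl δcl`, `hC : ∀ l κ κ′ κ₁ κ₂, zmode (b′^{rel,ε}_l) κ κ′ (inl κ₁) (inl κ₂) + zmode (b′^{rel,ε}_l) κ′ κ (inl κ₁)
(inl κ₂) = 0`.  Proof (the OWNER's (E) text): `hb := locStencil₂_add (locStencil₂_halfTable (Hb l) hε) (hcell l)` at `min δb δcl`; `hZ := ⟨covariance, hC l⟩`; T4.
WHAT THIS IS NOT.  `Hb`, `hcell`, `hC` are DISPLAYED (their (III′) suppliers: road-P2's source-row socket; leaf-03's (C-6) ⟸ four divergence letter rows; (C) at the comb data);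
asserts NO value of any charge; NOT «T2Drift^ε» (the drift twin `CombT2DriftEvenEndRows` is the next file), NOT one W-slot row; the (III′) campaign is NOT asked (an2 W-4 l.64553);
NEVER «G-an2-4 closed» as (CONV-C); NOT D1, NOT `BetaPertH`, NOT continuum, NOT Clay; not in print.  2026-08-25.
-/

noncomputable section

open Finset
open scoped BigOperators
open Literature.MathematicalPhysics.QuantumFieldTheory
open Literature.MathematicalPhysics.QuantumFieldTheory.Balaban1983to89
open Literature.MathematicalPhysics.QuantumFieldTheory.Balaban1983to89.Beta
open ExpKernelCalculus (MKer shiftK)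
open OneStepResolventKernel (Fib LocStencil)
open OneStepKernelFamily (KInvStep)
open SecondOrderResponse (W2SymOfK)
open BalabanCompositeJets (LocStencil₂ LocStencil₂.mono)
open BalabanStepJetsSucc (mmRead)
open BalabanStepW2 (K3OfK M2Of)
open Summit.QuantumFields.BalabanUV.Beta.TameKernelCalculus (trK)
open Summit.QuantumFields.BalabanUV.Beta.BorderedHessian (sgnK)
open Summit.QuantumFields.BalabanUV.Beta.HessKerDressedUnits (unitK unitS)
open Summit.QuantumFields.BalabanUV.Beta.SecondOrderUnits (unitM unitS₂ unitM₂)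
open Summit.QuantumFields.BalabanUV.Beta.SpineRooted (T2RecOf)
open Summit.QuantumFields.BalabanUV.Beta.SymmetrisedStepJets (SymTables)
open Summit.QuantumFields.BalabanUV.Beta.CombChartStepJets (GcombSh SpureCombOf)
open Summit.QuantumFields.BalabanUV.Beta.GAN24.CombesThomas (sfStep smStep)
open Summit.QuantumFields.BalabanUV.Beta.GAN24.T2RecursionAffine (lin4)
open Summit.QuantumFields.BalabanUV.Beta.GAN24.BiStencilZeroMode (zmode)
open Summit.QuantumFields.BalabanUV.Beta.GAN24.WSlotT2OfPieces (locStencil₂_add)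
open Summit.QuantumFields.BalabanUV.Beta.GAN24.WSlotForcingZeroModeW3 (add_translate_pi sub_translate_pi)
open Summit.QuantumFields.BalabanUV.Beta.GAN24.Lin4ZeroMode (lin4_translate shiftK_unitKInvStep)
open Summit.QuantumFields.BalabanUV.Beta.GAN24.T2ShapeEvenEnd (locStencil₂_halfTable)
open Summit.QuantumFields.BalabanUV.Beta.GAN24.CombT2ShapeEvenEnd (locStencil₂_halfMember_comb_three_of_relSource_rows)
open Summit.QuantumFields.BalabanUV.Beta.GAN24.CombLegTowerWindowSources (shiftK_unitK_GcombSh)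
open Summit.QuantumFields.BalabanUV.Beta.GAN24.CombLegSourceRuledClass (halfSource_comb_translate halfMember_comb_translate)

namespace Summit.QuantumFields.BalabanUV.Beta.GAN24.CombT2ShapeEvenEndRows

variable {Lc : ℕ} [NeZero Lc]

/-- NOT IN PRINT; OUR BOOKKEEPING.  **«T2Shape^ε» AT (III′) WITH THE RELATIVE SOURCE's ROWS DISCHARGED INTO `Hb ∕ hcell ∕ hC`** (`d = 3`, `2 ≤ Lc`, `|cE₂| ≤ Lc^8`, `|ε| ≤ 1`,
any `tabs : SymTables 3 Lc` with off-diagonal border localised at `(CB, δB)`): the OWNER's T4 socket with `hb := ½•(Hb + ε•P Hb) + hcell` (`locStencil₂_halfTable` ⨾ `locStencil₂_add`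
at `min δb δcl`) and `hZ := ⟨covariance — leaf-03's `halfSource_comb_translate` + `lin4_translate` at `shiftK_unitK_GcombSh ∕ shiftK_unitKInvStep` on `halfMember_comb_translate`,
glued by `add ∕ sub_translate_pi` —, hC l⟩`.  The (III′) twin of the OWNER gan24-p1 g33's `T2ShapeEvenEndRows.locStencil₂_halfMember_three_of_rows` (COURTESY; credit the OWNER). -/
theorem locStencil₂_halfMember_comb_three_of_rows (hLc : 2 ≤ Lc) (tabs : SymTables 3 Lc) (cE cVH cΛ cE₂ cB : ℝ)
    (hpin : |cE₂| ≤ (Lc : ℝ) ^ (2 * (3 + 1))) (Tc : Fin 4 → Fin 4 → Fin 4 → Fin 4 → ℝ)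
    (hBff : ∀ κ u κ' u' x z (α β : Fin (3 + 1)), tabs.vh₂S κ u κ' u' x z (Sum.inl α) (Sum.inl β) = 0)
    (hBmm : ∀ κ u κ' u' x z (μ ν : Fin (3 + 1)), tabs.vh₂S κ u κ' u' x z (Sum.inr μ) (Sum.inr ν) = 0)
    {CB δB : ℝ} (hB : LocStencil₂ tabs.vh₂S CB δB) (hδB : 0 < δB)
    (ε : ℝ) (hε : |ε| ≤ 1) {Cb δb : ℝ}
    (Hb : ∀ l : ℕ, LocStencil₂ (fun κ u κ' u' => (cE₂ * (Lc : ℝ) ^ (2 * (3 + 1))) • mmRead Lc (K3OfK (unitK (sfStep Lc l) (smStep 3 Lc l) (GcombSh (d := 3) Lc l)) Lc (unitS (sfStep Lc l) (smStep 3 Lc l) (SpureCombOf tabs cE cVH cΛ l)) (unitM (sfStep Lc l) (smStep 3 Lc l) (tabs.M l)) (W2SymOfK (unitK (sfStep Lc l) (smStep 3 Lc l) (GcombSh (d := 3) Lc l)) Lc (unitS (sfStep Lc l) (smStep 3 Lc l) (SpureCombOf tabs cE cVH cΛ l)) (unitM (sfStep Lc l) (smStep 3 Lc l) (tabs.M l))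 0 (unitM₂ (sfStep Lc l) (smStep 3 Lc l) (M2Of 3 Lc tabs.mixFF l))) κ u κ' u') + cB • tabs.vh₂S κ u κ' u') Cb δb)
    (hδb : 0 < δb) {Ccl δcl : ℝ}
    (hcell : ∀ l : ℕ, LocStencil₂
      (lin4 (cE₂ * (Lc : ℝ) ^ (2 * (3 + 1))) (unitK (sfStep Lc l) (smStep 3 Lc l) (GcombSh (d := 3) Lc l)) Lc (((1 : ℝ) / 2) • (unitS₂ (sfStep Lc l) (smStep 3 Lc l) (T2RecOf 3 Lc (GcombSh Lc) (SpureCombOf tabs cE cVH cΛ) tabs.M cE₂ cB Tc tabs.vh₂S tabs.mixFF l) + ε • fun κ u κ' u' => sgnK (trK ((unitS₂ (sfStep Lc l) (smStep 3 Lc l) (T2RecOf 3 Lc (GcombSh Lc) (SpureCombOf tabs cE cVH cΛ) tabs.M cE₂ cB Tc tabs.vh₂S tabs.mixFF l)) κ u κ' u'))))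
          - lin4 (cE₂ * (Lc : ℝ) ^ (2 * (3 + 1))) (unitK (sfStep Lc l) (smStep 3 Lc l) (KInvStep (d := 3) Lc l)) Lc (((1 : ℝ) / 2) • (unitS₂ (sfStep Lc l) (smStep 3 Lc l) (T2RecOf 3 Lc (GcombSh Lc) (SpureCombOf tabs cE cVH cΛ) tabs.M cE₂ cB Tc tabs.vh₂S tabs.mixFF l) + ε • fun κ u κ' u' => sgnK (trK ((unitS₂ (sfStep Lc l) (smStep 3 Lc l) (T2RecOf 3 Lc (GcombSh Lc) (SpureCombOf tabs cE cVH cΛ) tabs.M cE₂ cB Tc tabs.vh₂S tabs.mixFF l)) κ u κ' u'))))) Ccl δcl)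
    (hδcl : 0 < δcl)
    (hC : ∀ l : ℕ, (∀ κ κ' κ₁ κ₂, zmode Lc ((((1 : ℝ) / 2) • ((fun κ u κ' u' => (cE₂ * (Lc : ℝ) ^ (2 * (3 + 1))) • mmRead Lc (K3OfK (unitK (sfStep Lc l) (smStep 3 Lc l) (GcombSh (d := 3) Lc l)) Lc (unitS (sfStep Lc l) (smStep 3 Lc l) (SpureCombOf tabs cE cVH cΛ l)) (unitM (sfStep Lc l) (smStep 3 Lc l) (tabs.M l)) (W2SymOfK (unitK (sfStep Lc l) (smStep 3 Lc l) (GcombSh (d := 3) Lc l)) Lc (unitS (sfStep Lc l) (smStep 3 Lc l) (SpureCombOf tabs cE cVH cΛ l)) (unitM (sfStep Lc l) (smStep 3 Lc l) (tabs.M l)) 0 (unitM₂ (sfStep Lc l) (smStep 3 Lc l) (M2Of 3 Lc tabs.mixFF l))) κ u κ' u') + cB • tabs.vh₂S κ u κ' u') + ε • fun κ u κ' u' => sgnK (trK ((cE₂ * (Lc : ℝ) ^ (2 * (3 + 1))) • mmRead Lc (K3OfK (unitK (sfStep Lc l) (smStep 3 Lc l) (GcombSh (d := 3) Lc l)) Lc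 (unitS (sfStep Lc l) (smStep 3 Lc l) (SpureCombOf tabs cE cVH cΛ l)) (unitM (sfStep Lc l) (smStep 3 Lc l) (tabs.M l)) (W2SymOfK (unitK (sfStep Lc l) (smStep 3 Lc l) (GcombSh (d := 3) Lc l)) Lc (unitS (sfStep Lc l) (smStep 3 Lc l) (SpureCombOf tabs cE cVH cΛ l)) (unitM (sfStep Lc l) (smStep 3 Lc l) (tabs.M l)) 0 (unitM₂ (sfStep Lc l) (smStep 3 Lc l) (M2Of 3 Lc tabs.mixFF l))) κ u κ' u') + cB • tabs.vh₂S κ u κ' u')))) +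
          (lin4 (cE₂ * (Lc : ℝ) ^ (2 * (3 + 1))) (unitK (sfStep Lc l) (smStep 3 Lc l) (GcombSh (d := 3) Lc l)) Lc (((1 : ℝ) / 2) • (unitS₂ (sfStep Lc l) (smStep 3 Lc l) (T2RecOf 3 Lc (GcombSh Lc) (SpureCombOf tabs cE cVH cΛ) tabs.M cE₂ cB Tc tabs.vh₂S tabs.mixFF l) + ε • fun κ u κ' u' => sgnK (trK ((unitS₂ (sfStep Lc l) (smStep 3 Lc l) (T2RecOf 3 Lc (GcombSh Lc) (SpureCombOf tabs cE cVH cΛ) tabs.M cE₂ cB Tc tabs.vh₂S tabs.mixFF l)) κ u κ' u'))))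
          - lin4 (cE₂ * (Lc : ℝ) ^ (2 * (3 + 1))) (unitK (sfStep Lc l) (smStep 3 Lc l) (KInvStep (d := 3) Lc l)) Lc (((1 : ℝ) / 2) • (unitS₂ (sfStep Lc l) (smStep 3 Lc l) (T2RecOf 3 Lc (GcombSh Lc) (SpureCombOf tabs cE cVH cΛ) tabs.M cE₂ cB Tc tabs.vh₂S tabs.mixFF l) + ε • fun κ u κ' u' => sgnK (trK ((unitS₂ (sfStep Lc l) (smStep 3 Lc l) (T2RecOf 3 Lc (GcombSh Lc) (SpureCombOf tabs cE cVH cΛ) tabs.M cE₂ cB Tc tabs.vh₂S tabs.mixFF l)) κ u κ' u')))))) κ κ' (Sum.inl κ₁) (Sum.inl κ₂)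
        + zmode Lc ((((1 : ℝ) / 2) • ((fun κ u κ' u' => (cE₂ * (Lc : ℝ) ^ (2 * (3 + 1))) • mmRead Lc (K3OfK (unitK (sfStep Lc l) (smStep 3 Lc l) (GcombSh (d := 3) Lc l)) Lc (unitS (sfStep Lc l) (smStep 3 Lc l) (SpureCombOf tabs cE cVH cΛ l)) (unitM (sfStep Lc l) (smStep 3 Lc l) (tabs.M l)) (W2SymOfK (unitK (sfStep Lc l) (smStep 3 Lc l) (GcombSh (d := 3) Lc l)) Lc (unitS (sfStep Lc l) (smStep 3 Lc l) (SpureCombOf tabs cE cVH cΛ l)) (unitM (sfStep Lc l) (smStep 3 Lc l) (tabs.M l)) 0 (unitM₂ (sfStep Lc l) (smStep 3 Lc l) (M2Of 3 Lc tabs.mixFF l))) κ u κ' u') + cB • tabs.vh₂S κ u κ' u') + ε • fun κ u κ' u' => sgnK (trK ((cE₂ * (Lc : ℝ) ^ (2 * (3 + 1))) • mmRead Lc (K3OfK (unitK (sfStep Lc l) (smStep 3 Lc l) (GcombSh (d := 3) Lc l)) Lc (unitS (sfStep Lc l) (smStep 3 Lc l) (SpureCombOf tabs cE cVH cΛ l))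 (unitM (sfStep Lc l) (smStep 3 Lc l) (tabs.M l)) (W2SymOfK (unitK (sfStep Lc l) (smStep 3 Lc l) (GcombSh (d := 3) Lc l)) Lc (unitS (sfStep Lc l) (smStep 3 Lc l) (SpureCombOf tabs cE cVH cΛ l)) (unitM (sfStep Lc l) (smStep 3 Lc l) (tabs.M l)) 0 (unitM₂ (sfStep Lc l) (smStep 3 Lc l) (M2Of 3 Lc tabs.mixFF l))) κ u κ' u') + cB • tabs.vh₂S κ u κ' u')))) +
          (lin4 (cE₂ * (Lc : ℝ) ^ (2 * (3 + 1))) (unitK (sfStep Lc l) (smStep 3 Lc l) (GcombSh (d := 3) Lc l)) Lc (((1 : ℝ) / 2) • (unitS₂ (sfStep Lc l) (smStep 3 Lc l) (T2RecOf 3 Lc (GcombSh Lc) (SpureCombOf tabs cE cVH cΛ) tabs.M cE₂ cB Tc tabs.vh₂S tabs.mixFF l) + ε • fun κ u κ' u' => sgnK (trK ((unitS₂ (sfStep Lc l) (smStep 3 Lc l) (T2RecOf 3 Lc (GcombSh Lc) (SpureCombOf tabs cE cVH cΛ) tabs.M cE₂ cB Tc tabs.vh₂S tabs.mixFF l)) κ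 u κ' u'))))
          - lin4 (cE₂ * (Lc : ℝ) ^ (2 * (3 + 1))) (unitK (sfStep Lc l) (smStep 3 Lc l) (KInvStep (d := 3) Lc l)) Lc (((1 : ℝ) / 2) • (unitS₂ (sfStep Lc l) (smStep 3 Lc l) (T2RecOf 3 Lc (GcombSh Lc) (SpureCombOf tabs cE cVH cΛ) tabs.M cE₂ cB Tc tabs.vh₂S tabs.mixFF l) + ε • fun κ u κ' u' => sgnK (trK ((unitS₂ (sfStep Lc l) (smStep 3 Lc l) (T2RecOf 3 Lc (GcombSh Lc) (SpureCombOf tabs cE cVH cΛ) tabs.M cE₂ cB Tc tabs.vh₂S tabs.mixFF l)) κ u κ' u')))))) κ' κ (Sum.inl κ₁) (Sum.inl κ₂) = 0)) :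
    ∃ C₂ δ₂ : ℝ, 0 < δ₂ ∧ ∀ n, LocStencil₂ (((1 : ℝ) / 2) • (unitS₂ (sfStep Lc n) (smStep 3 Lc n) (T2RecOf 3 Lc (GcombSh Lc) (SpureCombOf tabs cE cVH cΛ) tabs.M cE₂ cB Tc tabs.vh₂S tabs.mixFF n) + ε • fun κ u κ' u' => sgnK (trK ((unitS₂ (sfStep Lc n) (smStep 3 Lc n) (T2RecOf 3 Lc (GcombSh Lc) (SpureCombOf tabs cE cVH cΛ) tabs.M cE₂ cB Tc tabs.vh₂S tabs.mixFF n)) κ u κ' u')))) C₂ δ₂ := by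
  have hm : 0 < min δb δcl := lt_min hδb hδcl
  have hY : ∀ (l : ℕ) (κ : Fin (3 + 1)) (u : Fin (3 + 1) → ℤ) (κ' : Fin (3 + 1)) (u' t : Fin (3 + 1) → ℤ),
      (((1 : ℝ) / 2) • (unitS₂ (sfStep Lc l) (smStep 3 Lc l) (T2RecOf 3 Lc (GcombSh Lc) (SpureCombOf tabs cE cVH cΛ) tabs.M cE₂ cB Tc tabs.vh₂S tabs.mixFF l) + ε • fun κ u κ' u' => sgnK (trK ((unitS₂ (sfStep Lc l) (smStep 3 Lc l) (T2RecOf 3 Lc (GcombSh Lc) (SpureCombOf tabs cE cVH cΛ) tabs.M cE₂ cB Tc tabs.vh₂S tabs.mixFF l)) κ u κ' u')))) κ (u + (Lc : ℤ) • t) κ' (u' + (Lc : ℤ) • t)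
        = shiftK (-((Lc : ℤ) • t)) ((((1 : ℝ) / 2) • (unitS₂ (sfStep Lc l) (smStep 3 Lc l) (T2RecOf 3 Lc (GcombSh Lc) (SpureCombOf tabs cE cVH cΛ) tabs.M cE₂ cB Tc tabs.vh₂S tabs.mixFF l) + ε • fun κ u κ' u' => sgnK (trK ((unitS₂ (sfStep Lc l) (smStep 3 Lc l) (T2RecOf 3 Lc (GcombSh Lc) (SpureCombOf tabs cE cVH cΛ) tabs.M cE₂ cB Tc tabs.vh₂S tabs.mixFF l)) κ u κ' u')))) κ u κ' u') :=
    fun l κ u κ' u' t => halfMember_comb_translate tabs cE cVH cΛ cE₂ cB Tc ε l κ u κ' u' t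
  exact locStencil₂_halfMember_comb_three_of_relSource_rows hLc tabs cE cVH cΛ cE₂ cB hpin Tc hBff hBmm hB hδB ε hε
    (fun l => locStencil₂_add ((locStencil₂_halfTable (Hb l) hε).mono (min_le_left _ _)) ((hcell l).mono (min_le_right _ _))) hm
    (fun l => ⟨fun κ u κ' u' t => add_translate_pi (w := (Lc : ℤ) • t) (v := -((Lc : ℤ) • t))
        (fun κ u κ' u' => halfSource_comb_translate tabs cE cVH cΛ cE₂ cB Tc hBff hBmm ε l κ u κ' u' t)
        (sub_translate_pi (w := (Lc : ℤ) • t) (v := -((Lc : ℤ) • t))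
          (fun κ u κ' u' => lin4_translate (shiftK_unitK_GcombSh (d := 3) (Lc := Lc) l) _ (hY l) κ u κ' u' ((Lc : ℤ) • t))
          (fun κ u κ' u' => lin4_translate (shiftK_unitKInvStep (d := 3) (Lc := Lc) l) _ (hY l) κ u κ' u' ((Lc : ℤ) • t)))
        κ u κ' u', hC l⟩)

end Summit.QuantumFields.BalabanUV.Beta.GAN24.CombT2ShapeEvenEndRows

end
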